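import Literature.NumberTheory.GaloisRepresentations.RayClassGroup
import Literature.NumberTheory.GaloisRepresentations.CyclotomicFrobenius
import HarnessLib

/-!
# The image of the Artin homomorphism of a Galois Frobenius datum is bounded by `[L : K]`

Topic `NumberTheory/GaloisRepresentations` (class field theory, next to `RayClassGroup.lean`,
`ArtinMapKernelGlue.lean`); namespace `Literature.NumberTheory.GaloisRepresentations`.  Theorems only,
fully proved.

For a finite Galois extension `L/K` of number fields, a homomorphism `χ : Gal(L/K) → G` to a
commutative group and the Frobenius datum `𝔮 ↦ χ(Frob_𝔮)` (`galFrob`), the Artin homomorphism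
`A = artinHom (χ ∘ Frob)` (`RayClassGroup.lean`) takes values in `χ(Gal(L/K))`; hence for every
`𝔪` the index `[J_K^𝔪 : ker A ∩ J_K^𝔪] = #A(J_K^𝔪)` is finite and at most `#Gal(L/K) = [L : K]`
(`relIndex_ker_artinHom_inf_le_finrank`, `relIndex_ker_artinHom_inf_ne_zero`).  This is the trivial
half of "the Artin map `ℐ_F(𝔪) → G` is surjective" (Childress, *Class Field Theory*, Ch. 5 Thm. 2.1 (i),
PDF p. 116; the non-trivial half, that the Frobenii generate, is the tree's `closure_frobenius_eq_top`),
in the form of the hypotheses `hle`, `hfin` of `ray_le_ker_artinHom_of_relIndex_le`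
(`ArtinMapKernelGlue.lean`).

## References

* N. Childress, *Class Field Theory*, Universitext, Springer 2009, Ch. 5 §2 Thm. 2.1 (i) and its proof
  (PDF p. 116). [Childress2009]
-/

noncomputable section

open NumberField IsDedekindDomain

open scoped nonZeroDivisors

namespace Literature.NumberTheory.GaloisRepresentations

variable {K : Type*} [Field K] [NumberField K]

/-- The Artin homomorphism of `f` takes values in any subgroup containing all the `f 𝔭`. [folklore] -/
theorem artinHom_mem_of_forall_mem {G : Type*} [CommGroup G] {f : HeightOneSpectrum (𝓞 K) → G}
    {H : Subgroup G} (hf : ∀ v, f v ∈ H) (I : (FractionalIdeal (𝓞 K)⁰ K)ˣ) : artinHom f I ∈ H := by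
  rw [artinHom_apply]
  exact finprod_induction (· ∈ H) H.one_mem (fun _ _ => H.mul_mem) fun v => H.zpow_mem (hf v) _

variable {L : Type*} [Field L] [NumberField L] [Algebra K L] [IsGalois K L]
variable {G : Type*} [CommGroup G] (χ : (L ≃ₐ[K] L) →* G) (𝔪 : Ideal (𝓞 K))

/-- The image of `J_K^𝔪` under the Artin homomorphism of `𝔮 ↦ χ(Frob_𝔮)` lies in `χ(Gal(L/K))`.
[folklore] -/
theorem map_artinHom_le_range :
    (idealsPrimeTo 𝔪).map (artinHom fun v => χ (galFrob K L v)) ≤ χ.range := by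
  rintro _ ⟨I, -, rfl⟩
  exact artinHom_mem_of_forall_mem (fun v => MonoidHom.mem_range.mpr ⟨galFrob K L v, rfl⟩) I

/-- **`[J_K^𝔪 : ker A ∩ J_K^𝔪] ≤ [L : K]`** for the Artin homomorphism `A` of `𝔮 ↦ χ(Frob_𝔮)`
(`#A(J_K^𝔪) ≤ #χ(Gal(L/K)) ≤ #Gal(L/K) = [L:K]`).  Ref: Childress, *Class Field Theory*, Ch. 5,
Thm. 2.1 (i) (the Artin map into `G = Gal(K/F)`). [cite: Childress2009, Ch. 5 §2 Thm. 2.1 (i) (PDF p. 116)] -/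
theorem relIndex_ker_artinHom_inf_le_finrank :
    ((artinHom fun v => χ (galFrob K L v)).ker ⊓ idealsPrimeTo 𝔪).relIndex (idealsPrimeTo 𝔪) ≤
      Module.finrank K L := by
  rw [Subgroup.inf_relIndex_right, Subgroup.relIndex_ker, ← IsGalois.card_aut_eq_finrank K L]
  haveI : Finite χ.range := Set.finite_range χ |>.to_subtype
  calc Nat.card ((idealsPrimeTo 𝔪).map (artinHom fun v => χ (galFrob K L v)))
      ≤ Nat.card χ.range := Nat.card_mono (Set.toFinite _) (map_artinHom_le_range χ 𝔪)
    _ ≤ Nat.card (L ≃ₐ[K] L) := Nat.card_le_card_of_surjective _ (MonoidHom.rangeRestrict_surjective χ)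

/-- **`[J_K^𝔪 : ker A ∩ J_K^𝔪]` is finite (nonzero)** for the Artin homomorphism of `𝔮 ↦ χ(Frob_𝔮)`.
[folklore] -/
theorem relIndex_ker_artinHom_inf_ne_zero :
    ((artinHom fun v => χ (galFrob K L v)).ker ⊓ idealsPrimeTo 𝔪).relIndex (idealsPrimeTo 𝔪) ≠ 0 := by
  rw [Subgroup.inf_relIndex_right, Subgroup.relIndex_ker]
  haveI : Finite χ.range := Set.finite_range χ |>.to_subtype
  haveI : Finite ((idealsPrimeTo 𝔪).map (artinHom fun v => χ (galFrob K L v))) :=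
    Finite.Set.subset (χ.range : Set G) (map_artinHom_le_range χ 𝔪)
  exact Nat.card_pos.ne'

end Literature.NumberTheory.GaloisRepresentations
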